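import Mathlib
import HarnessLib
import Literature.Probability.MarkovChains.TotalVariation
import Summits.Ventures.LatticeQCDFlow.Exactness.JarzynskiFinite
import Summits.Ventures.LatticeQCDFlow.Scaling.StochasticFlows

/-!
# Marginals of a finite non-equilibrium chain and lazy perfect-relaxation layers

HONEST FRAMING: exact (Metropolis-corrected) sampling algorithms for lattice gauge theory;
figures of merit are autocorrelation/cost numbers at stated couplings and volumes; no
continuum-physics claim.

Venture `LatticeQCDFlow` (cell pub-lqcd), topic `Exactness`, FANOUT row 8 (s0-cpn-nemc, GEN-5).
OUR WORK (elementary finite sums), nothing cited as a fact.  Bookkeeping for the LAG LAW of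
`Exactness/LazyRelaxationLagLaw.lean` (what an UNDER-relaxed switching protocol dissipates above
row 8's quasi-static floor), over the tree's path-space vocabulary (`pathLaw`, `work` of
`JarzynskiFinite`; `stepLaw`, `lawAt`, `IsRowStochastic`, `IsStationary` of
`Literature.Probability.MarkovChains`):

* `evolveLaw` — the marginal laws `μ_0 = μ`, `μ_{j+1} = μ_j P_j` of a time-INhomogeneous chain
  (`stepLaw` iterated along a sequence of kernels); `sum_evolveLaw` (mass), `evolveLaw_succ_eq_sum`
  (peeling the first step);
* `sum_pathLaw_mul_apply` — **the path-space mean of a function of the `j`-th configuration is its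
  mean under the `j`-th marginal**, and `meanWork_eq_sum_evolveLaw` —
  **`⟨W⟩ = Σ_j E_{μ_j}[S_{j+1} − S_j]`** for a protocol `S_0, …, S_n` and ANY layers with unit row
  sums (general tool: the switch `j → j+1` acts on a configuration distributed as `μ_j`);
* `lazyLayer π ε` — the LAZY PERFECT-RELAXATION layer `ε·I + (1 − ε)·Π` onto a law `π` (stay with
  probability `ε`, else resample from `π`; the `A`-monotone lazy layers of
  `Scaling/PerfectRelaxationMonotone`, `ε = 0` being the perfect relaxation of `QuasiStaticPathKL`):
  unit row sums, non-negativity / positivity of the entries (`0 ≤ ε ≤ 1` / `< 1`),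
  `isStationary_lazyLayer_gibbs` (the Boltzmann weight is invariant, so these ARE admissible
  NE-MCMC layers: `jarzynski`, `kl_path_eq_dissipation` apply), `stepLaw_lazyLayer`
  (`μP = ε μ + (1 − ε) π`), `lawAt_lazyLayer` (`μP^t = ε^t μ + (1 − ε^t) π`), and
  **`cov_lazyLayer_lawAt`**: in equilibrium `E_π[f(X_0) g(X_t)] − ⟨f⟩⟨g⟩ = ε^t (⟨fg⟩ − ⟨f⟩⟨g⟩)` —
  EVERY observable decorrelates geometrically with ratio `ε`, so its integrated autocorrelation
  time is `Scoring.tauInt (fun t => ε^t) = (1 + ε)/(2(1 − ε))` (`Scoring/CalibrationTruths`,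
  `tauInt_geometric`; the `τ_int` that enters the lag law).
-/

namespace Summit.Ventures.LatticeQCDFlow.Exactness

open Finset
open Literature.Probability.MarkovChains (IsRowStochastic IsStationary stepLaw lawAt lawAt_zero
  lawAt_succ)
open Summit.Ventures.LatticeQCDFlow.Theory2

variable {X : Type*} [Fintype X]

/-! ## Marginal laws of a time-inhomogeneous chain; the mean of a one-time observable -/

/-- The marginal law after `j` steps of the chain with kernels `P 0, P 1, …` started from `μ`:
`μ_0 = μ`, `μ_{j+1} = μ_j P_j` (`stepLaw`). -/
def evolveLaw (P : ℕ → X → X → ℝ) (μ : X → ℝ) : ℕ → X → ℝ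
  | 0 => μ
  | j + 1 => stepLaw (P j) (evolveLaw P μ j)

/-- `μ_0 = μ`. -/
@[simp] theorem evolveLaw_zero (P : ℕ → X → X → ℝ) (μ : X → ℝ) : evolveLaw P μ 0 = μ := rfl

/-- `μ_{j+1} = μ_j P_j`. -/
theorem evolveLaw_succ (P : ℕ → X → X → ℝ) (μ : X → ℝ) (j : ℕ) :
    evolveLaw P μ (j + 1) = stepLaw (P j) (evolveLaw P μ j) := rfl

/-- Layers with unit row sums preserve the total mass of the marginals. -/
theorem sum_evolveLaw (P : ℕ → X → X → ℝ) (hP : ∀ k x, ∑ y, P k x y = 1) (μ : X → ℝ) :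
    ∀ j, ∑ y, evolveLaw P μ j y = ∑ x, μ x
  | 0 => rfl
  | j + 1 => by
      rw [evolveLaw_succ, ← sum_evolveLaw P hP μ j]
      unfold stepLaw
      rw [sum_comm]
      exact sum_congr rfl fun x _ => by rw [← mul_sum, hP j x, mul_one]

/-- Peeling the FIRST step: `μ_{j+1} = Σ_x μ(x) · [the chain `P 1, P 2, …` started from the row
`P 0 x`]_j`. -/
theorem evolveLaw_succ_eq_sum (P : ℕ → X → X → ℝ) (μ : X → ℝ) :
    ∀ (j : ℕ) (y : X), evolveLaw P μ (j + 1) y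
      = ∑ x, μ x * evolveLaw (fun k => P (k + 1)) (P 0 x) j y
  | 0, y => by simp [evolveLaw, stepLaw]
  | j + 1, y => by
      have ih := evolveLaw_succ_eq_sum P μ j
      show stepLaw (P (j + 1)) (evolveLaw P μ (j + 1)) y
        = ∑ x, μ x * stepLaw (P (j + 1)) (evolveLaw (fun k => P (k + 1)) (P 0 x) j) y
      unfold stepLaw
      simp_rw [ih, sum_mul, mul_sum, mul_assoc]
      exact sum_comm

/-- **Mean of a one-time observable.**  For layers with unit row sums the path-space expectation of
a function of the `j`-th configuration is its expectation under the `j`-th marginal: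
`Σ_ω P_path(ω) g(ω_j) = Σ_y μ_j(y) g(y)`. -/
theorem sum_pathLaw_mul_apply : ∀ (n : ℕ) (μ : X → ℝ) (P : ℕ → X → X → ℝ),
    (∀ k x, ∑ y, P k x y = 1) → ∀ (j : Fin (n + 1)) (g : X → ℝ),
    ∑ ω : Fin (n + 1) → X, pathLaw μ (fun k : Fin n => P k) ω * g (ω j)
      = ∑ y, evolveLaw P μ j y * g y
  | 0, μ, P, _, j, g => by
      rw [sum_path_zero, Fin.fin_one_eq_zero j]
      refine sum_congr rfl fun x _ => ?_
      simp [pathLaw, transProb]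
  | n + 1, μ, P, hP, j, g => by
      rw [sum_path_cons]
      have hpl : ∀ (x₀ : X) (ω : Fin (n + 1) → X),
          pathLaw μ (fun k : Fin (n + 1) => P k) (Fin.cons x₀ ω : Fin (n + 2) → X)
            = μ x₀ * pathLaw (P 0 x₀) (fun k : Fin n => P (k + 1)) ω := by
        intro x₀ ω
        simp only [pathLaw, transProb_cons, Fin.cons_zero, Fin.val_zero, Fin.val_succ]
      have hrow : ∀ x₀, ∑ ω : Fin (n + 1) → X, pathLaw (P 0 x₀) (fun k : Fin n => P (k + 1)) ω
          = 1 := fun x₀ => by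
        rw [sum_pathLaw _ _ (fun k x => hP (k + 1) x), hP 0 x₀]
      refine Fin.cases ?_ (fun i => ?_) j
      · simp only [Fin.cons_zero, Fin.val_zero, evolveLaw_zero]
        refine sum_congr rfl fun x₀ _ => ?_
        simp_rw [hpl]
        rw [← sum_mul, ← mul_sum, hrow x₀, mul_one]
      · simp only [Fin.cons_succ, Fin.val_succ]
        have ih := sum_pathLaw_mul_apply n
        calc ∑ x₀, ∑ ω : Fin (n + 1) → X,
              pathLaw μ (fun k : Fin (n + 1) => P k) (Fin.cons x₀ ω : Fin (n + 2) → X) * g (ω i)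
            = ∑ x₀, μ x₀ * ∑ y, evolveLaw (fun k => P (k + 1)) (P 0 x₀) i y * g y := by
              refine sum_congr rfl fun x₀ _ => ?_
              rw [← ih (P 0 x₀) (fun k => P (k + 1)) (fun k x => hP (k + 1) x) i g, mul_sum]
              exact sum_congr rfl fun ω _ => by rw [hpl]; ring
          _ = ∑ y, evolveLaw P μ (i + 1) y * g y := by
              simp_rw [evolveLaw_succ_eq_sum P μ i, sum_mul, mul_sum, mul_assoc]
              exact sum_comm

/-- **Mean work = `Σ_j E_{μ_j}[S_{j+1} − S_j]`** for a protocol `S 0, …, S n` and ANY layers with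
unit row sums (the switch `j → j+1` acts on a configuration distributed as the `j`-th marginal). -/
theorem meanWork_eq_sum_evolveLaw (n : ℕ) (μ : X → ℝ) (S : ℕ → X → ℝ) (P : ℕ → X → X → ℝ)
    (hP : ∀ k x, ∑ y, P k x y = 1) :
    ∑ ω : Fin (n + 1) → X, pathLaw μ (fun k : Fin n => P k) ω * work (fun k : Fin (n + 1) => S k) ω
      = ∑ j ∈ range n, ∑ y, evolveLaw P μ j y * (S (j + 1) y - S j y) := by
  unfold work
  simp only [Fin.val_succ, Fin.val_castSucc]
  simp_rw [mul_sum]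
  rw [sum_comm, ← Fin.sum_univ_eq_sum_range]
  exact sum_congr rfl fun k _ =>
    sum_pathLaw_mul_apply n μ P hP k.castSucc (fun y => S (k + 1) y - S k y)

/-! ## Lazy perfect-relaxation layers -/

section Lazy

variable [DecidableEq X]

/-- The LAZY PERFECT-RELAXATION layer onto a law `π` with laziness `ε`: stay with probability `ε`,
otherwise resample from `π` independently of the current configuration
(`P x y = ε·[y = x] + (1 − ε)·π y`, the `ε·I + (1−ε)·Π` of `Scaling/PerfectRelaxationMonotone`). -/
def lazyLayer (π : X → ℝ) (ε : ℝ) (x y : X) : ℝ :=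
  ε * (if y = x then 1 else 0) + (1 - ε) * π y

omit [Fintype X] in
/-- `ε = 0` is perfect relaxation (the layer `fun _ y => π y` of `QuasiStaticPathKL`). -/
theorem lazyLayer_zero (π : X → ℝ) : lazyLayer π 0 = fun _ y => π y := by
  funext x y
  simp [lazyLayer]

/-- Unit row sums (for a normalised `π`). -/
theorem sum_lazyLayer {π : X → ℝ} (hπ : ∑ y, π y = 1) (ε : ℝ) (x : X) :
    ∑ y, lazyLayer π ε x y = 1 := by
  have h1 : ∑ y, ε * (if y = x then (1:ℝ) else 0) = ε := by
    rw [← mul_sum]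
    simp only [Finset.sum_ite_eq', Finset.mem_univ, if_true, mul_one]
  have h2 : ∑ y, (1 - ε) * π y = 1 - ε := by rw [← mul_sum, hπ, mul_one]
  unfold lazyLayer
  rw [sum_add_distrib, h1, h2]
  ring

omit [Fintype X] in
/-- Non-negative entries for `0 ≤ ε ≤ 1` and `π ≥ 0`. -/
theorem lazyLayer_nonneg {π : X → ℝ} (hπ : ∀ y, 0 ≤ π y) {ε : ℝ} (h0 : 0 ≤ ε) (h1 : ε ≤ 1)
    (x y : X) : 0 ≤ lazyLayer π ε x y := by
  unfold lazyLayer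
  have : 0 ≤ (1 - ε) * π y := mul_nonneg (sub_nonneg.mpr h1) (hπ y)
  split_ifs <;> nlinarith

omit [Fintype X] in
/-- Positive entries for `0 ≤ ε < 1` and `π > 0`. -/
theorem lazyLayer_pos {π : X → ℝ} (hπ : ∀ y, 0 < π y) {ε : ℝ} (h0 : 0 ≤ ε) (h1 : ε < 1)
    (x y : X) : 0 < lazyLayer π ε x y := by
  unfold lazyLayer
  have : 0 < (1 - ε) * π y := mul_pos (sub_pos.mpr h1) (hπ y)
  split_ifs <;> nlinarith

/-- Row-stochastic for `0 ≤ ε ≤ 1` and a probability vector `π`. -/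
theorem isRowStochastic_lazyLayer {π : X → ℝ} (hπ : ∀ y, 0 ≤ π y) (hπ1 : ∑ y, π y = 1) {ε : ℝ}
    (h0 : 0 ≤ ε) (h1 : ε ≤ 1) : IsRowStochastic (lazyLayer π ε) :=
  ⟨lazyLayer_nonneg hπ h0 h1, sum_lazyLayer hπ1 ε⟩

/-- The lazy layer onto the Gibbs law of `S` leaves the Boltzmann weight `e^{−S}` invariant (so it is
an admissible NE-MCMC layer: `jarzynski`, `kl_path_eq_dissipation` apply). -/
theorem isStationary_lazyLayer_gibbs [Nonempty X] (S : X → ℝ) (ε : ℝ) :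
    IsStationary (fun x => Real.exp (-(S x))) (lazyLayer (gibbsLaw S) ε) := by
  intro y
  have hZ := (partitionFn_pos S).ne'
  have h1 : ∑ x, Real.exp (-(S x)) * (ε * if y = x then 1 else 0) = ε * Real.exp (-(S y)) := by
    simp only [mul_ite, mul_one, mul_zero, Finset.sum_ite_eq, Finset.mem_univ, if_true]
    ring
  have h2 : ∑ x, Real.exp (-(S x)) * ((1 - ε) * gibbsLaw S y) = (1 - ε) * Real.exp (-(S y)) := by
    rw [← sum_mul, show (∑ x, Real.exp (-(S x))) = partitionFn S from rfl]
    unfold gibbsLaw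
    field_simp
  unfold lazyLayer
  simp_rw [mul_add, sum_add_distrib]
  rw [h1, h2]
  ring

/-- One lazy step on laws: `μ P = ε μ + (1 − ε) π` for a normalised `μ`. -/
theorem stepLaw_lazyLayer (π : X → ℝ) (ε : ℝ) {μ : X → ℝ} (hμ : ∑ x, μ x = 1) (y : X) :
    stepLaw (lazyLayer π ε) μ y = ε * μ y + (1 - ε) * π y := by
  have h1 : ∑ x, μ x * (ε * if y = x then 1 else 0) = ε * μ y := by
    simp only [mul_ite, mul_one, mul_zero, Finset.sum_ite_eq, Finset.mem_univ, if_true]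
    ring
  have h2 : ∑ x, μ x * ((1 - ε) * π y) = (1 - ε) * π y := by rw [← sum_mul, hμ, one_mul]
  unfold stepLaw lazyLayer
  simp_rw [mul_add, sum_add_distrib]
  rw [h1, h2]

/-- `t` lazy steps on laws: `μ P^t = ε^t μ + (1 − ε^t) π`. -/
theorem lawAt_lazyLayer (π : X → ℝ) (hπ : ∑ y, π y = 1) (ε : ℝ) {μ : X → ℝ} (hμ : ∑ x, μ x = 1) :
    ∀ (t : ℕ) (y : X), lawAt (lazyLayer π ε) μ t y = ε ^ t * μ y + (1 - ε ^ t) * π y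
  | 0, y => by simp [lawAt_zero]
  | t + 1, y => by
      have ih := lawAt_lazyLayer π hπ ε hμ t
      have hmass : ∑ x, lawAt (lazyLayer π ε) μ t x = 1 := by
        simp_rw [ih, sum_add_distrib, ← mul_sum, hμ, hπ]
        ring
      rw [lawAt_succ, stepLaw_lazyLayer π ε hmass, ih]
      ring

/-- **Geometric decorrelation in equilibrium.**  For the stationary lazy chain and any observables
`f, g`: `E_π[f(X_0) g(X_t)] − ⟨f⟩⟨g⟩ = ε^t · (⟨f g⟩ − ⟨f⟩⟨g⟩)` — every observable's normalised
autocorrelation function is `ε^t`, whose integrated autocorrelation time is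
`Scoring.tauInt (fun t => ε^t) = (1 + ε)/(2(1 − ε))` (`Scoring.tauInt_geometric`). -/
theorem cov_lazyLayer_lawAt (π : X → ℝ) (hπ : ∑ y, π y = 1) (ε : ℝ) (f g : X → ℝ) (t : ℕ) :
    ∑ x, π x * f x * (∑ y, lawAt (lazyLayer π ε) (fun z => if z = x then 1 else 0) t y * g y)
        - (∑ x, π x * f x) * (∑ y, π y * g y)
      = ε ^ t * (∑ x, π x * (f x * g x) - (∑ x, π x * f x) * (∑ y, π y * g y)) := by
  have hδ : ∀ x : X, ∑ z, (fun z => if z = x then (1:ℝ) else 0) z = 1 := by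
    intro x
    simp only [Finset.sum_ite_eq', Finset.mem_univ, if_true]
  have hinner : ∀ x, ∑ y, lawAt (lazyLayer π ε) (fun z => if z = x then 1 else 0) t y * g y
      = ε ^ t * g x + (1 - ε ^ t) * ∑ y, π y * g y := by
    intro x
    simp_rw [lawAt_lazyLayer π hπ ε (hδ x) t, add_mul, sum_add_distrib, mul_assoc, ← mul_sum]
    congr 1
    simp only [ite_mul, one_mul, zero_mul, Finset.sum_ite_eq', Finset.mem_univ, if_true]
  simp_rw [hinner]
  generalize (∑ y, π y * g y) = G
  simp_rw [mul_add, sum_add_distrib]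
  have e1 : ∑ x, π x * f x * (ε ^ t * g x) = ε ^ t * ∑ x, π x * (f x * g x) := by
    rw [mul_sum]
    exact sum_congr rfl fun x _ => by ring
  have e2 : ∑ x, π x * f x * ((1 - ε ^ t) * G) = (1 - ε ^ t) * ((∑ x, π x * f x) * G) := by
    rw [sum_mul, mul_sum]
    exact sum_congr rfl fun x _ => by ring
  rw [e1, e2]
  ring

end Lazy

end Summit.Ventures.LatticeQCDFlow.Exactness
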